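import Summits.HodgeConjecture.HodgeConjecture.Theorems.EndoscopicMiddleDegreeAlgebraicOrEnvelopedOfBetAlone
import HarnessLib

/-!
# `AlgebraicOrEnveloped` IS its restriction to core-fixed classes
# (crux `EndoscopicMiddleDegree.AlgebraicOrEnveloped`, stmt-HodgeConjecture-14943, line `core-splitting-ladder`, lead seat c4)

A fact-free EQUIVALENCE pinning the content of the crux (rank 5, THE DICHOTOMY) to the Hecke CORES: `AlgebraicOrEnveloped` holds
iff its conclusion `c ∈ algebraicClasses X n ⊔ span {enveloped}` holds for the rational `(n,n)`-classes `c` FIXED BY A CORE `ε`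
(`ε c = c`; a core = an impure ℚ-block of the Hecke algebra surviving the coefficient-conjugation sieve). `→` is specialisation; `←` is
the block decomposition of `…OfBetAlone` (p119631) with the core hypothesis weakened from "`ε e ∈ Alg`" (THE BET, registered stub
`stub_coreHodgeClassesAlgebraic`) to "`ε e ∈ Alg ⊔ span {enveloped}`": pure blocks self-envelope, killed blocks vanish, and a core's
`ε c` is itself a rational `(n,n)`-class fixed by `ε`. Consequences recorded for the planner: the registered bet implies the crux
(p119631) and the crux implies the bet's `Alg ⊔ Env`-weakening — every line for this crux must prove exactly "algebraic-or-enveloped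
for core-fixed classes", nothing less and nothing more.

References: BMM arXiv:1306.1515 Part 2 §1.8–1.9, Thm. 61; Arancibia–Moeglin–Renard arXiv:1507.01432 §8.
-/

noncomputable section
set_option linter.dupNamespace false -- `Summit.<P>.<Sub>.Theorems.…` repeats `HodgeConjecture` (single-conjunct summit)

namespace Summit.HodgeConjecture.HodgeConjecture.Theorems.CoreSplittingLadder

open scoped BigOperators
open CategoryTheory MonoidalCategory CartesianMonoidalCategory
open Literature.AlgebraicGeometry.Motives (SchemeOver ComplexPoints IsSmoothProjective)
open Literature.AlgebraicGeometry.HodgeTheory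
open Literature.AlgebraicGeometry.ShimuraVarieties
open Literature.AlgebraicTopology.SingularHomology
open Summit.HodgeConjecture.HodgeConjecture.Theses.EndoscopicMiddleDegree (AlgebraicOrEnveloped)
open Summit.HodgeConjecture.HodgeConjecture.Cruxes.MiddleThetaSpan.ConjugateDimensionSieve (IsPrimitiveCentralIdempotent)
open Summit.HodgeConjecture.HodgeConjecture.Cruxes.OrthogonalEnveloped.ImpureBarrenEnvelope (stub_rationalBlocks)
open Summit.HodgeConjecture.HodgeConjecture.Cruxes.OrthogonalEnveloped.PuritySortedHeckeEnvelope
  (stub_killedBarren heckeHodgeType)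

/-- **The crux at one datum, granted "algebraic-or-enveloped" for the images of its cores** (the weakest blockwise hypothesis):
if every CORE `ε` of the Hecke algebra on `H²ⁿ(X(ℂ); ℂ)` maps every rational `(n,n)`-class into
`algebraicClasses X n ⊔ span {enveloped}`, then every rational `(n,n)`-class lies there — `c = Σ_ε ε c` over the ℚ-blocks
(`stub_rationalBlocks`); pure blocks self-envelope (`P_{γ_ε} = ε`, idempotent; `γ_ε` algebraic by
`exists_algebraic_corrAction_eq_of_mem_adjoin`), killed blocks vanish on `c` (`stub_killedBarren` + `heckeHodgeType`).
[cite: BergeronMillsonMoeglin2016Balls, Part 2 §1.9 and Thm. 61] -/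
theorem mem_algebraic_sup_enveloped_of_cores_sup {m : ℕ} {X : SchemeOver ℂ}
    (D : UnitaryBallQuotientDatum (2 * (m + 1)) X) (hm1 : 1 ≤ m) (hm2 : m ≤ 2)
    (hCore : ∀ ε : Module.End ℂ (complexBetti X (2 * (m + 1))),
        ε ∈ Algebra.adjoin ℂ (Set.range (D.heckeCorrespondenceAction (2 * (m + 1)))) →
        ε * ε = ε →
        (∀ T ∈ Algebra.adjoin ℂ (Set.range (D.heckeCorrespondenceAction (2 * (m + 1)))),
          T * ε = ε * T) →
        (∀ β, IsRationalClass β → IsRationalClass (ε β)) →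
        (∀ (p q : ℕ) (x : complexBetti X (2 * (m + 1))), IsOfHodgeType (2 * (m + 1)) X (2 * (m + 1)) p q x →
          IsOfHodgeType (2 * (m + 1)) X (2 * (m + 1)) p q (ε x)) →
        (∀ f ∈ Algebra.adjoin ℂ (Set.range (D.heckeCorrespondenceAction (2 * (m + 1)))),
          f * f = f →
          (∀ T ∈ Algebra.adjoin ℂ (Set.range (D.heckeCorrespondenceAction (2 * (m + 1)))),
            T * f = f * T) →
          (∀ β, IsRationalClass β → IsRationalClass (f β)) → f * ε = 0 ∨ f * ε = ε) →
        (∃ β, ¬ IsOfHodgeType (2 * (m + 1)) X (2 * (m + 1)) (m + 1) (m + 1) (ε β)) →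
        (∃ z : Module.End ℂ (complexBetti X (2 * (m + 1))),
          IsPrimitiveCentralIdempotent
              (Algebra.adjoin ℂ (Set.range (D.heckeCorrespondenceAction (2 * (m + 1))))) z ∧
            z * ε = z ∧
              ∀ σ : ℂ ≃+* ℂ, ∃ c : complexBetti X (2 * (m + 1)),
                IsOfHodgeType (2 * (m + 1)) X (2 * (m + 1)) (m + 1) (m + 1) (conjEnd σ z c) ∧
                  conjEnd σ z c ≠ 0) →
        ∀ e : complexBetti X (2 * (m + 1)), IsRationalClass e →
          IsOfHodgeType (2 * (m + 1)) X (2 * (m + 1)) (m + 1) (m + 1) e →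
          ε e ∈ algebraicClasses X (m + 1) ⊔ Submodule.span ℂ {e : complexBetti X (2 * (m + 1)) | IsRationalClass e ∧
            ∃ μ : OrientationFamily, μ.HasPoincareDuality ∧ ∃ γ ∈ algebraicClasses (X ⊗ X) (2 * (m + 1)),
              let P : complexBetti X (2 * (m + 1)) → complexBetti X (2 * (m + 1)) := fun β =>
                complexGysin μ (IsSmoothProjective.tensor_holds D.isSmoothProjective D.isSmoothProjective)
                  D.isSmoothProjective (fst X X)
                  (show 2 * (m + 1) + 2 * (2 * (m + 1)) + 2 * (2 * (m + 1)) =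
                    2 * (m + 1) + 2 * (2 * (m + 1) + 2 * (m + 1)) by ring)
                  (cupProduct (rfl : 2 * (m + 1) + 2 * (2 * (m + 1)) = 2 * (m + 1) + 2 * (2 * (m + 1)))
                    (complexBetti.map (snd X X) (2 * (m + 1)) β) γ);
              (∀ β, IsRationalClass β → IsRationalClass (P β)) ∧
                (∀ β, IsOfHodgeType (2 * (m + 1)) X (2 * (m + 1)) (m + 1) (m + 1) (P β)) ∧ P e = e})
    (c : complexBetti X (2 * (m + 1))) (hc : IsRationalClass c)
    (hH : IsOfHodgeType (2 * (m + 1)) X (2 * (m + 1)) (m + 1) (m + 1) c) :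
    c ∈ algebraicClasses X (m + 1) ⊔ Submodule.span ℂ {e : complexBetti X (2 * (m + 1)) | IsRationalClass e ∧
      ∃ μ : OrientationFamily, μ.HasPoincareDuality ∧ ∃ γ ∈ algebraicClasses (X ⊗ X) (2 * (m + 1)),
        let P : complexBetti X (2 * (m + 1)) → complexBetti X (2 * (m + 1)) := fun β =>
          complexGysin μ (IsSmoothProjective.tensor_holds D.isSmoothProjective D.isSmoothProjective)
            D.isSmoothProjective (fst X X)
            (show 2 * (m + 1) + 2 * (2 * (m + 1)) + 2 * (2 * (m + 1)) = 2 * (m + 1) + 2 * (2 * (m + 1) + 2 * (m + 1)) by ring)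
            (cupProduct (rfl : 2 * (m + 1) + 2 * (2 * (m + 1)) = 2 * (m + 1) + 2 * (2 * (m + 1)))
              (complexBetti.map (snd X X) (2 * (m + 1)) β) γ);
        (∀ β, IsRationalClass β → IsRationalClass (P β)) ∧
          (∀ β, IsOfHodgeType (2 * (m + 1)) X (2 * (m + 1)) (m + 1) (m + 1) (P β)) ∧ P e = e} := by
  classical
  obtain ⟨μ, hμ⟩ := exists_orientationFamily_hasPoincareDuality
  -- the ℚ-blocks of the Hecke algebra (landed, p87916)
  obtain ⟨s, hblk, -, hsum⟩ := stub_rationalBlocks m X D hm1 hm2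
  -- each block is the action of an ALGEBRAIC class
  have hεS : ∀ ε ∈ s, ∃ γ ∈ algebraicClasses (X ⊗ X) (2 * (m + 1)),
      corrAction μ D.isSmoothProjective D.isSmoothProjective
        (rfl : 2 * (m + 1) + 2 * (2 * (m + 1)) = 2 * (m + 1) + 2 * (2 * (m + 1))) γ = ε :=
    fun ε hε ↦ exists_algebraic_corrAction_eq_of_mem_adjoin hμ D hm1 hm2 (hblk ε hε).1
  choose! γf hγf hPγ using hεS
  -- `c = Σ_ε ε c`
  have hc_sum : c = ∑ ε ∈ s, ε c := by
    conv_lhs => rw [show c = (∑ ε ∈ s, ε) c by rw [hsum]; rfl]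
    rw [LinearMap.sum_apply]
  rw [hc_sum]
  refine Submodule.sum_mem _ fun ε hε ↦ ?_
  obtain ⟨h1, h2, h3, h4, h5⟩ := hblk ε hε
  by_cases hpure : ∀ β, IsOfHodgeType (2 * (m + 1)) X (2 * (m + 1)) (m + 1) (m + 1) (ε β)
  · -- a PURE block: `ε c` is enveloped by `γ_ε` itself
    refine Submodule.mem_sup_right (Submodule.subset_span ⟨h4 c hc, μ, hμ, γf ε, hγf ε hε, ?_⟩)
    intro P
    have hPβ : ∀ β, P β = ε β := fun β ↦ by
      change corrAction μ D.isSmoothProjective D.isSmoothProjective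
        (rfl : 2 * (m + 1) + 2 * (2 * (m + 1)) = 2 * (m + 1) + 2 * (2 * (m + 1))) (γf ε) β = _
      rw [hPγ ε hε]
    refine ⟨fun β hβ ↦ ?_, fun β ↦ ?_, ?_⟩
    · rw [hPβ]; exact h4 β hβ
    · rw [hPβ]; exact hpure β
    · rw [hPβ, ← Module.End.mul_apply, h2]
  · -- an IMPURE block: killed (sieve) or a core (hypothesis)
    by_cases hK : ∀ z : Module.End ℂ (complexBetti X (2 * (m + 1))),
        IsPrimitiveCentralIdempotent
            (Algebra.adjoin ℂ (Set.range (D.heckeCorrespondenceAction (2 * (m + 1))))) z →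
          z * ε = z →
            ∃ σ : ℂ ≃+* ℂ, ∀ c : complexBetti X (2 * (m + 1)),
              IsOfHodgeType (2 * (m + 1)) X (2 * (m + 1)) (m + 1) (m + 1) (conjEnd σ z c) →
                conjEnd σ z c = 0
    · -- (K) a KILLED block: `ε c = 0`
      rw [stub_killedBarren m X D hm1 hm2 (fun a ha x hx ↦ heckeHodgeType D ha x hx) ε h1 h2 h3 hK c hc hH]
      exact zero_mem _
    · -- (C) a CORE
      push Not at hK
      exact hCore ε h1 h2 h3 h4 (fun p q x hx ↦ heckeHodgeType D h1 x hx) h5 (not_forall.1 hpure) hK c hc hH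

/-- **`AlgebraicOrEnveloped` ⟺ "algebraic-or-enveloped for CORE-FIXED classes"** (fact-free). The right-hand side is the crux's
own conclusion demanded only of the rational `(n,n)`-classes `c` with `ε c = c` for some CORE `ε` (impure, sieve-surviving ℚ-block of
the Hecke algebra; the shape of the registered bet `stub_coreHodgeClassesAlgebraic` with its conclusion weakened from `Alg` to
`Alg ⊔ span {enveloped}` and its classes restricted to the core's fixed vectors). `→`: specialise. `←`: for a core `ε` and any rational
`(n,n)`-class `e`, `ε e` is rational (`ε` is a ℚ-block), `(n,n)` (`heckeHodgeType`) and fixed by `ε` (idempotency), so the hypothesis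
applies to it, and `mem_algebraic_sup_enveloped_of_cores_sup` assembles the blocks. Hence every proof of the crux is a proof about core
classes and nothing else; the registered bet (`ε e ∈ Alg`) is the `Alg`-normalised strengthening of the right-hand side.
[cite: BergeronMillsonMoeglin2016Balls, Part 2 §1.9 and Thm. 61] [cite: ArancibiaMoeglinRenard2015, §8] -/
theorem algebraicOrEnveloped_iff_coreFixed :
    AlgebraicOrEnveloped ↔
    (∀ (m : ℕ) (X : SchemeOver ℂ) (D : UnitaryBallQuotientDatum (2 * (m + 1)) X), 1 ≤ m → m ≤ 2 →
      (∀ a : complexBetti X (2 * m), IsRationalClass a →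
        IsOfHodgeType (2 * (m + 1)) X (2 * m) m m a → a ∈ algebraicClasses X m) →
      ∀ ε : Module.End ℂ (complexBetti X (2 * (m + 1))),
        ε ∈ Algebra.adjoin ℂ (Set.range (D.heckeCorrespondenceAction (2 * (m + 1)))) →
        ε * ε = ε →
        (∀ T ∈ Algebra.adjoin ℂ (Set.range (D.heckeCorrespondenceAction (2 * (m + 1)))),
          T * ε = ε * T) →
        (∀ β, IsRationalClass β → IsRationalClass (ε β)) →
        (∀ (p q : ℕ) (x : complexBetti X (2 * (m + 1))), IsOfHodgeType (2 * (m + 1)) X (2 * (m + 1)) p q x →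
          IsOfHodgeType (2 * (m + 1)) X (2 * (m + 1)) p q (ε x)) →
        (∀ f ∈ Algebra.adjoin ℂ (Set.range (D.heckeCorrespondenceAction (2 * (m + 1)))),
          f * f = f →
          (∀ T ∈ Algebra.adjoin ℂ (Set.range (D.heckeCorrespondenceAction (2 * (m + 1)))),
            T * f = f * T) →
          (∀ β, IsRationalClass β → IsRationalClass (f β)) → f * ε = 0 ∨ f * ε = ε) →
        (∃ β, ¬ IsOfHodgeType (2 * (m + 1)) X (2 * (m + 1)) (m + 1) (m + 1) (ε β)) →
        (∃ z : Module.End ℂ (complexBetti X (2 * (m + 1))),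
          IsPrimitiveCentralIdempotent
              (Algebra.adjoin ℂ (Set.range (D.heckeCorrespondenceAction (2 * (m + 1))))) z ∧
            z * ε = z ∧
              ∀ σ : ℂ ≃+* ℂ, ∃ c : complexBetti X (2 * (m + 1)),
                IsOfHodgeType (2 * (m + 1)) X (2 * (m + 1)) (m + 1) (m + 1) (conjEnd σ z c) ∧
                  conjEnd σ z c ≠ 0) →
        ∀ c : complexBetti X (2 * (m + 1)), IsRationalClass c →
          IsOfHodgeType (2 * (m + 1)) X (2 * (m + 1)) (m + 1) (m + 1) c → ε c = c →
          c ∈ algebraicClasses X (m + 1) ⊔ Submodule.span ℂ {e : complexBetti X (2 * (m + 1)) | IsRationalClass e ∧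
            ∃ μ : OrientationFamily, μ.HasPoincareDuality ∧ ∃ γ ∈ algebraicClasses (X ⊗ X) (2 * (m + 1)),
              let P : complexBetti X (2 * (m + 1)) → complexBetti X (2 * (m + 1)) := fun β =>
                complexGysin μ (IsSmoothProjective.tensor_holds D.isSmoothProjective D.isSmoothProjective)
                  D.isSmoothProjective (fst X X)
                  (show 2 * (m + 1) + 2 * (2 * (m + 1)) + 2 * (2 * (m + 1)) =
                    2 * (m + 1) + 2 * (2 * (m + 1) + 2 * (m + 1)) by ring)
                  (cupProduct (rfl : 2 * (m + 1) + 2 * (2 * (m + 1)) = 2 * (m + 1) + 2 * (2 * (m + 1)))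
                    (complexBetti.map (snd X X) (2 * (m + 1)) β) γ);
              (∀ β, IsRationalClass β → IsRationalClass (P β)) ∧
                (∀ β, IsOfHodgeType (2 * (m + 1)) X (2 * (m + 1)) (m + 1) (m + 1) (P β)) ∧ P e = e}) := by
  refine ⟨fun h m X D hm1 hm2 hlow ε _ _ _ _ _ _ _ _ c hc hH _ ↦ h m X D hm1 hm2 hlow c hc hH, fun h ↦ ?_⟩
  intro m X D hm1 hm2 hlow c hc hH
  refine mem_algebraic_sup_enveloped_of_cores_sup D hm1 hm2 (fun ε h1 h2 h3 h4 hT h5 himp hK e he heH ↦ ?_) c hc hH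
  refine h m X D hm1 hm2 hlow ε h1 h2 h3 h4 hT h5 himp hK (ε e) (h4 e he) (hT _ _ e heH) ?_
  rw [← Module.End.mul_apply, h2]

end Summit.HodgeConjecture.HodgeConjecture.Theorems.CoreSplittingLadder

end
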